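import Literature.Probability.RandomPlanarGeometry.SLEOnePointLowerEstimate
import Literature.Probability.RandomPlanarGeometry.CritPercSLESpaceFillingIffTraceEight
import Literature.Probability.RandomPlanarGeometry.CritPercSLE
import Literature.Probability.RandomPlanarGeometry.SLE
import Literature.Probability.RandomPlanarGeometry.SLEExistenceConverse
import Literature.Probability.RandomPlanarGeometry.CurveSpace
import Summits.CriticalPhenomena.SAWScalingLimit.Theorems.SAWRenewalTightnessSubseqIdentificationWindowTransport
import HarnessLib

/-!
# `stub_kappaLeOfUpper`: an upper `r²` boundary area bound on an SLE_κ law forces `κ ≤ 8/3`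

Stub S6⁺ `stub_kappaLeOfUpper` of the registered skeleton of the line `boundary-area-law`
(restriction reshape) for the crux `SubseqIdentification` (stmt-CriticalPhenomena-0783, route
`SAWRenewalTightness`; primary decl `SAWParafermion.SubseqIdentification`). It is the "`κ ≤ 8/3`"
half of the landed two-sided κ-pin (`stub_kappaPinHalfPlane`, `stub_windowTransport`,
`stub_kappaPinGlue`), and needs neither a lower bound nor a non-degeneracy hypothesis.

Statement. If `μ` is the chordal SLE_κ law (`κ > 0`) of a Dobrushin domain `(D; a, b)` with a flat
horizontal window `D ∩ B(x₀, ρ₀) = {im z > im x₀} ∩ B(x₀, ρ₀)` at a wall point `x₀ ∉ {a, b}`, and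
`μ[dist(x₀, trace) < r] ≤ C r²` for all `r ∈ (0, r₀)`, then `κ ≤ 8/3`.

Proof.
* Bookkeeping (`stub_kappaLeOfUpper`): `μ = P.map Γ` with, almost surely, `Γ ω` the class of the
  time-compactified image `c_ω` of the trace `γ = sleTrace κ ω` under the boundary extension `Φ`
  of a chordal uniformizing map `φ` (`IsSLELaw`, `IsSLECurve`, `IsCompactifiedImage`); SLE_κ is
  generated by a curve (`IsSLELaw.hasSLETrace`). The flat-window transport `stub_windowTransport`
  gives a real `u₀ ≠ 0` with `Φ` Lipschitz (constant `L`) at `u₀` over `x₀` on the closed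
  half-plane near `u₀`; deterministically `dist(u₀, γ) < ρ ≤ η ⇒ dist(x₀, c_ω) < L ρ`
  (`infDist_image_lt_of_window`), so `P[dist(u₀, γ) < ρ] ≤ P[Γ ∈ {dist < Lρ}] ≤ μ[dist < Lρ]`
  (`measure_mono_ae`, `Measure.le_map_apply`) `≤ C L² ρ²` for `ρ < min(η, r₀/L)`.
* Half-plane pin, upper half (`kappa_le_of_upper`): for `κ ≥ 8` the trace is a.s. space-filling
  (`ae_isSpaceFilling_sleTrace_of_hasSLETrace_apply`, Rohde–Schramm 2005, Cor. 7.4), so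
  `P[dist(u₀, γ) < ρ] = 1` for every `ρ > 0` (`measure_lt_eq_one_of_eight_le`), contradicting
  `≤ C' ρ²` for `ρ` small; for `κ < 8` Beffara's interior one-point LOWER estimate
  (`measure_infDist_sleTrace_le_ge`, Beffara 2008, Prop. 4) at `z = u₀ + iρ/2`, `ε = ρ/4`, with
  the closed form `rsGhatSlope_critical` of the Rohde–Schramm profile, gives
  `A ρ^{8/κ-1} ≤ C' ρ²` for small `ρ`, hence `2 ≤ 8/κ - 1` (`two_le_exponent_of_upper`), i.e.
  `κ ≤ 8/3`.

The private lemmas `measure_lt_eq_one_of_eight_le`, `lowerEstimate_boundary'`,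
`two_le_exponent_of_upper` are adapted (near verbatim) from the private lemmas of the landed
`Theorems/SAWRenewalTightnessSubseqIdentificationKappaPinHalfPlane.lean` (p96666), and
`infDist_image_lt_of_window` from `…KappaPinGlue.lean` (p96964).

Sources: V. Beffara, *The dimension of the SLE curves*, Ann. Probab. 36 (2008), Prop. 4;
S. Rohde, O. Schramm, *Basic properties of SLE*, Ann. Math. 161 (2005), Lemma 6.3, Cor. 7.4.
No named fact is used beyond PROVED tree theorems; axioms `propext`, `Classical.choice`,
`Quot.sound`.
-/

open MeasureTheory Filter Topology Set Metric
open scoped NNReal ENNReal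

namespace Summit.CriticalPhenomena.SAWScalingLimit.Theorems.SubseqIdentification.BoundaryAreaLaw

open Literature.Probability.RandomPlanarGeometry
open Literature.Probability.Process (preWienerMeasure)
open UpperHalfPlane (upperHalfPlaneSet)

variable {κ : ℝ≥0}

/-! ## The half-plane pin, upper half -/

/-- For `κ ≥ 8` the SLE_κ trace is a.s. space-filling (Rohde–Schramm 2005, Cor. 7.4), so every
real point `u₀` lies a.s. ON the trace and the event `{dist(u₀, γ[0,∞)) < ρ}` has probability
one for every `ρ > 0`. [folklore] -/
private theorem measure_lt_eq_one_of_eight_le (hκ8 : 8 ≤ κ) (hT : HasSLETrace κ)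
    (u₀ : ℝ) {ρ : ℝ} (hρ : 0 < ρ) :
    preWienerMeasure {ω | infDist (u₀ : ℂ) (range (sleTrace κ ω)) < ρ} = 1 := by
  -- adapted from `…KappaPinHalfPlane.lean`, `measure_infDist_lt_eq_one_of_eight_le`
  haveI := isProbabilityMeasure_preWienerMeasure'
  have hmem : ∀ᵐ ω ∂preWienerMeasure,
      ω ∈ {ω | infDist (u₀ : ℂ) (range (sleTrace κ ω)) < ρ} := by
    filter_upwards [ae_isSpaceFilling_sleTrace_of_hasSLETrace_apply hκ8 hT] with ω hω
    have hrange : range (sleTrace κ ω) = closure upperHalfPlaneSet := hω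
    have hu : (u₀ : ℂ) ∈ range (sleTrace κ ω) := by
      rw [hrange, show upperHalfPlaneSet = {w : ℂ | 0 < w.im} from rfl,
        Complex.closure_setOf_lt_im]
      simp
    show infDist (u₀ : ℂ) (range (sleTrace κ ω)) < ρ
    rw [infDist_zero_of_mem hu]
    exact hρ
  exact (measure_congr (ae_eq_univ.2 (mem_ae_iff.1 hmem))).trans measure_univ

/-- Beffara's interior one-point lower estimate (Beffara 2008, Prop. 4; tree:
`measure_infDist_sleTrace_le_ge`) read at the boundary: looking at `z = u₀ + iρ/2` with
`ε = ρ/4` (`dist(z, γ) ≤ ρ/4 ⇒ dist(u₀, γ) ≤ 3ρ/4`),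
`P[dist(u₀, γ[0,∞)) ≤ 3ρ/4] ≥ ½ Ĝ_{1-κ/8,κ}(2u₀/ρ) (1/4)^{1-κ/8}` for `0 < κ < 8`, `ρ > 0`.
[cite: Beffara2008, Prop. 4] -/
private theorem lowerEstimate_boundary' (hκ : 0 < κ) (hκ8 : κ < 8) (hT : HasSLETrace κ)
    (u₀ : ℝ) {ρ : ℝ} (hρ : 0 < ρ) :
    ENNReal.ofReal (rsGhatSlope (1 - (κ : ℝ) / 8) κ (u₀ / (ρ / 2)) / 2 *
        (1 / 4 : ℝ) ^ (1 - (κ : ℝ) / 8)) ≤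
      preWienerMeasure {ω | infDist (u₀ : ℂ) (range (sleTrace κ ω)) ≤ 3 * ρ / 4} := by
  -- adapted from `…KappaPinHalfPlane.lean`, `lowerEstimate_boundary`
  set z : ℂ := ⟨u₀, ρ / 2⟩ with hz
  have hzim : z.im = ρ / 2 := rfl
  have hzre : z.re = u₀ := rfl
  have hzim0 : 0 < z.im := by rw [hzim]; positivity
  have hε : (0 : ℝ) < ρ / 4 := by positivity
  have hεz : ρ / 4 < z.im := by rw [hzim]; linarith
  have h := measure_infDist_sleTrace_le_ge hκ hκ8 hT hzim0 hε hεz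
  rw [hzre, hzim] at h
  have h4 : ρ / 4 / (2 * (ρ / 2)) = 1 / 4 := by
    field_simp
  rw [h4] at h
  refine h.trans (measure_mono fun ω hω => ?_)
  simp only [mem_setOf_eq] at hω ⊢
  have hdist : dist (u₀ : ℂ) z = ρ / 2 := by
    rw [Complex.dist_of_re_eq (by simp [hzre]), Complex.ofReal_im, hzim, Real.dist_eq,
      zero_sub, abs_neg, abs_of_pos (by positivity)]
  calc infDist (u₀ : ℂ) (range (sleTrace κ ω))
      ≤ infDist z (range (sleTrace κ ω)) + dist (u₀ : ℂ) z := infDist_le_infDist_add_dist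
    _ ≤ ρ / 4 + ρ / 2 := add_le_add hω hdist.le
    _ = 3 * ρ / 4 := by ring

/-- Beffara's lower bound `P[dist(u₀, γ[0,∞)) ≤ 3ρ/4] ≥ (A/D) ρ^{8/κ-1}` (for `ρ ≤ |u₀|`) against
an upper area law `P[dist < ρ] ≤ C ρ²` for small `ρ` forces `2 ≤ 8/κ - 1` (`0 < κ < 8`,
`u₀ ≠ 0`): otherwise `A/D ≤ C ρ^{2-β} → 0` as `ρ → 0+`. [cite: Beffara2008, Prop. 4] -/
private theorem two_le_exponent_of_upper (hκ : 0 < κ) (hκ8 : κ < 8) (hT : HasSLETrace κ)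
    {u₀ : ℝ} (hu₀ : u₀ ≠ 0) {C ρ₀ : ℝ} (hρ₀ : 0 < ρ₀)
    (H : ∀ ρ ∈ Ioo (0 : ℝ) ρ₀,
      preWienerMeasure {ω | infDist (u₀ : ℂ) (range (sleTrace κ ω)) < ρ} ≤
        ENNReal.ofReal (C * ρ ^ 2)) :
    2 ≤ 8 / (κ : ℝ) - 1 := by
  -- adapted from `…KappaPinHalfPlane.lean`, `two_le_exponent`
  have hκ0 : (0 : ℝ) < κ := by exact_mod_cast hκ
  have hκne : (κ : ℝ) ≠ 0 := hκ0.ne'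
  have hκ8' : (κ : ℝ) < 8 := by exact_mod_cast hκ8
  obtain ⟨β, hβ⟩ : ∃ β : ℝ, β = 8 / (κ : ℝ) - 1 := ⟨_, rfl⟩
  rw [← hβ]
  have hβ0 : 0 < β := by
    have h8 : (1 : ℝ) < 8 / κ := (one_lt_div hκ0).2 hκ8'
    rw [hβ]
    linarith
  by_contra! h2
  have ha : 0 < |u₀| := abs_pos.2 hu₀
  -- the constants
  obtain ⟨A, hA⟩ : ∃ A : ℝ, A = (1 / 4 : ℝ) ^ (1 - (κ : ℝ) / 8) / 2 := ⟨_, rfl⟩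
  have hA0 : 0 < A := by rw [hA]; positivity
  obtain ⟨D, hD⟩ : ∃ D : ℝ, D = (5 * u₀ ^ 2) ^ (β / 2) := ⟨_, rfl⟩
  have hD0 : 0 < D := by rw [hD]; exact Real.rpow_pos_of_pos (by positivity) _
  have hexp : -((8 - (κ : ℝ)) / (2 * κ)) = -(β / 2) := by
    rw [hβ, div_sub_one hκne]
    ring
  have key : ∀ᶠ ρ in 𝓝[>] (0 : ℝ), A / D ≤ C * ρ ^ (2 - β) := by
    have hδ : (0 : ℝ) < min ρ₀ |u₀| := lt_min hρ₀ ha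
    filter_upwards [Ioo_mem_nhdsGT hδ] with ρ hρ
    obtain ⟨hρ0, hρδ⟩ := hρ
    have hρ₀' : ρ < ρ₀ := hρδ.trans_le (min_le_left _ _)
    have hρu : ρ ≤ |u₀| := hρδ.le.trans (min_le_right _ _)
    -- the chain `ofReal (Ĝ/2 (1/4)^a) ≤ P[dist ≤ 3ρ/4] ≤ P[dist < ρ] ≤ ofReal (C ρ²)`
    have h1 := lowerEstimate_boundary' hκ hκ8 hT u₀ hρ0
    have h12 : preWienerMeasure {ω | infDist (u₀ : ℂ) (range (sleTrace κ ω)) ≤ 3 * ρ / 4} ≤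
        preWienerMeasure {ω | infDist (u₀ : ℂ) (range (sleTrace κ ω)) < ρ} :=
      measure_mono fun ω hω => by
        simp only [mem_setOf_eq] at hω ⊢
        linarith
    have h3 := (h1.trans h12).trans (H ρ ⟨hρ0, hρ₀'⟩)
    -- the slope factor: `(A/D) ρ^β ≤ Ĝ(2u₀/ρ)/2 (1/4)^a`
    have hg : A / D * ρ ^ β ≤ rsGhatSlope (1 - (κ : ℝ) / 8) κ (u₀ / (ρ / 2)) / 2 *
        (1 / 4 : ℝ) ^ (1 - (κ : ℝ) / 8) := by
      rw [rsGhatSlope_critical hκ0, hexp]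
      have hw : 1 + (u₀ / (ρ / 2)) ^ 2 ≤ 5 * u₀ ^ 2 / ρ ^ 2 := by
        rw [le_div_iff₀ (by positivity)]
        have hρ2 : ρ ^ 2 ≤ u₀ ^ 2 := by
          calc ρ ^ 2 ≤ |u₀| ^ 2 := by gcongr
            _ = u₀ ^ 2 := sq_abs u₀
        have h' : (u₀ / (ρ / 2)) ^ 2 * ρ ^ 2 = 4 * u₀ ^ 2 := by
          field_simp
          ring
        nlinarith [h']
      have hlow : (5 * u₀ ^ 2 / ρ ^ 2) ^ (-(β / 2)) ≤ (1 + (u₀ / (ρ / 2)) ^ 2) ^ (-(β / 2)) :=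
        Real.rpow_le_rpow_of_nonpos (by positivity) hw (by linarith)
      have hrew : (5 * u₀ ^ 2 / ρ ^ 2) ^ (-(β / 2)) = ρ ^ β / D := by
        rw [Real.rpow_neg (by positivity), Real.div_rpow (by positivity) (by positivity), inv_div,
          hD]
        congr 1
        rw [← Real.rpow_natCast, ← Real.rpow_mul hρ0.le]
        congr 1
        push_cast
        ring
      calc A / D * ρ ^ β = ρ ^ β / D * A := by ring
        _ ≤ (1 + (u₀ / (ρ / 2)) ^ 2) ^ (-(β / 2)) * A := by
            rw [← hrew]
            exact mul_le_mul_of_nonneg_right hlow hA0.le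
        _ = _ := by rw [hA]; ring
    have h4 : A / D * ρ ^ β ≤ C * ρ ^ 2 := by
      have h5 : ENNReal.ofReal (A / D * ρ ^ β) ≤ ENNReal.ofReal (C * ρ ^ 2) :=
        (ENNReal.ofReal_le_ofReal hg).trans h3
      rcases ENNReal.ofReal_le_ofReal_iff'.1 h5 with h | h
      · exact h
      · exact absurd h (not_le.2 (by positivity))
    have hρβ : 0 < ρ ^ β := Real.rpow_pos_of_pos hρ0 β
    rw [Real.rpow_sub hρ0 2 β, Real.rpow_two, mul_div_assoc', le_div_iff₀ hρβ]
    exact h4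
  have hlim : Tendsto (fun ρ : ℝ => C * ρ ^ (2 - β)) (𝓝[>] 0) (𝓝 0) := by
    have h0 : Tendsto (fun ρ : ℝ => ρ ^ (2 - β)) (𝓝 (0 : ℝ)) (𝓝 0) := by
      have h := (Real.continuousAt_rpow_const 0 (2 - β) (Or.inr (by linarith))).tendsto
      rwa [Real.zero_rpow (by linarith : 2 - β ≠ 0)] at h
    have h : Tendsto (fun ρ : ℝ => C * ρ ^ (2 - β)) (𝓝[>] 0) (𝓝 (C * 0)) :=
      (h0.mono_left nhdsWithin_le_nhds).const_mul C
    rwa [mul_zero] at h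
  have := ge_of_tendsto hlim key
  have : 0 < A / D := div_pos hA0 hD0
  linarith

/-- **The half-plane pin, upper half.** For `κ > 0` with `HasSLETrace κ` and a real `u₀ ≠ 0`, an
upper area law `P[dist(u₀, γ[0,∞)) < ρ] ≤ C ρ²` for all `ρ ∈ (0, ρ₀)` forces `κ ≤ 8/3`: for
`κ < 8` by `two_le_exponent_of_upper` (`2 ≤ 8/κ - 1`), and `κ ≥ 8` is impossible since then
`P[dist < ρ] = 1` for every `ρ > 0` (`measure_lt_eq_one_of_eight_le`) while `C ρ² < 1` for `ρ`
small. [folklore] -/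
private theorem kappa_le_of_upper (hκ : 0 < κ) (hT : HasSLETrace κ) {u₀ : ℝ} (hu₀ : u₀ ≠ 0)
    {C ρ₀ : ℝ} (hρ₀ : 0 < ρ₀)
    (H : ∀ ρ ∈ Ioo (0 : ℝ) ρ₀,
      preWienerMeasure {ω | infDist (u₀ : ℂ) (range (sleTrace κ ω)) < ρ} ≤
        ENNReal.ofReal (C * ρ ^ 2)) :
    κ ≤ 8 / 3 := by
  rcases lt_or_ge κ 8 with hκ8 | hκ8
  · have hge := two_le_exponent_of_upper hκ hκ8 hT hu₀ hρ₀ H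
    have hκ0 : (0 : ℝ) < κ := by exact_mod_cast hκ
    have h3 : (3 : ℝ) ≤ 8 / κ := by linarith
    rw [le_div_iff₀ hκ0] at h3
    have hκR : (κ : ℝ) ≤ 8 / 3 := by linarith
    exact_mod_cast hκR
  · -- `κ ≥ 8`: `P[dist < ρ] = 1 ≤ C ρ² < 1` for `ρ` small
    -- adapted from `…KappaPinHalfPlane.lean`, `stub_kappaPinHalfPlane` (ii), case `κ ≥ 8`
    exfalso
    obtain ⟨ρ, hρ⟩ : ∃ ρ : ℝ, ρ = min (ρ₀ / 2) (1 / (|C| + 2)) := ⟨_, rfl⟩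
    have hC2 : 0 < |C| + 2 := by positivity
    have hρ0 : 0 < ρ := by rw [hρ]; exact lt_min (by positivity) (by positivity)
    have hρ₀' : ρ < ρ₀ := by rw [hρ]; exact (min_le_left _ _).trans_lt (by linarith)
    have hρ1 : ρ ≤ 1 / (|C| + 2) := by rw [hρ]; exact min_le_right _ _
    have hρle1 : ρ ≤ 1 := hρ1.trans (by rw [div_le_one hC2]; linarith [abs_nonneg C])
    have h := H ρ ⟨hρ0, hρ₀'⟩
    rw [measure_lt_eq_one_of_eight_le hκ8 hT u₀ hρ0] at h
    have hlt : C * ρ ^ 2 < 1 := by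
      have h1 : C * ρ ^ 2 ≤ |C| * ρ ^ 2 :=
        mul_le_mul_of_nonneg_right (le_abs_self C) (sq_nonneg ρ)
      have hρsq : ρ ^ 2 ≤ ρ := by nlinarith
      have h2 : |C| * ρ ^ 2 ≤ |C| * ρ := mul_le_mul_of_nonneg_left hρsq (abs_nonneg C)
      have h3 : |C| * ρ ≤ |C| * (1 / (|C| + 2)) := mul_le_mul_of_nonneg_left hρ1 (abs_nonneg C)
      have h4 : |C| * (1 / (|C| + 2)) < 1 := by
        rw [mul_one_div, div_lt_one hC2]
        linarith
      linarith
    exact (not_lt.2 h) (ENNReal.ofReal_lt_one.2 hlt)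

/-! ## Deterministic transport `ℍ → D` through the compactified image -/

/-- **Transport `ℍ → D`, strict form.** If the half-plane curve `γ` (in the closed half-plane)
comes within distance `< ρ ≤ η` of `u₀`, then its compactified image `c` under `Φ` comes within
distance `< L ρ` of `x₀`, by the Lipschitz bound of `Φ` at `u₀` (a trace point `ρ`-close to `u₀`
is mapped `Lρ`-close to `x₀`, and its image is a point of `c`, `exists_rayParam_eq`).
[folklore] -/
private theorem infDist_image_lt_of_window {Φ : ℂ → ℂ} {γ : ℝ≥0 → ℂ} {b x₀ : ℂ} {c : Curve ℂ}
    {u₀ L η : ℝ} (hc : IsCompactifiedImage Φ γ b c) (him : ∀ t, 0 ≤ (γ t).im) (hL : 0 < L)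
    (hLip : ∀ u : ℂ, 0 ≤ u.im →
      (dist u (u₀ : ℂ) < η → dist (Φ u) x₀ ≤ L * dist u (u₀ : ℂ)) ∧
        (dist (Φ u) x₀ < η → dist u (u₀ : ℂ) ≤ L * dist (Φ u) x₀))
    {ρ : ℝ} (hρ : ρ ≤ η) (h : Metric.infDist (u₀ : ℂ) (Set.range γ) < ρ) :
    Metric.infDist x₀ c.range < L * ρ := by
  -- adapted from `…KappaPinGlue.lean`, `infDist_image_lt`
  obtain ⟨y, hy, hty⟩ := (Metric.infDist_lt_iff (Set.range_nonempty γ)).1 h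
  obtain ⟨t, rfl⟩ := Set.mem_range.1 hy
  rw [dist_comm] at hty
  obtain ⟨s, hs, hst⟩ := exists_rayParam_eq t
  have hmem : Φ (γ t) ∈ c.range := Curve.mem_range.2 ⟨s, by rw [hc.1 s hs, hst]⟩
  calc Metric.infDist x₀ c.range ≤ dist x₀ (Φ (γ t)) := Metric.infDist_le_dist_of_mem hmem
    _ = dist (Φ (γ t)) x₀ := dist_comm _ _
    _ ≤ L * dist (γ t) (u₀ : ℂ) := (hLip (γ t) (him t)).1 (hty.trans_le hρ)
    _ < L * ρ := by gcongr

/-! ## The stub -/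

/-- **S6⁺ — an upper `r²` boundary area bound pins `κ ≤ 8/3`** (registered stub
`stub_kappaLeOfUpper` of the line `boundary-area-law`, restriction reshape, crux
`SubseqIdentification`, stmt-CriticalPhenomena-0783). If `μ` is the chordal SLE_κ law (`κ > 0`) of
a Dobrushin domain with a flat horizontal window at `x₀ ∉ {a, b}` and
`μ[dist(x₀, trace) < r] ≤ C r²` for all `r ∈ (0, r₀)`, then `κ ≤ 8/3`. Proof: `μ = P.map Γ` with
a.s. `Γ ω` the class of the compactified image of `sleTrace κ ω` (`IsSLELaw`, `IsSLECurve`,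
`IsCompactifiedImage`, `IsSLELaw.hasSLETrace`); transport to the half-plane at the real point
`u₀ ≠ 0` over `x₀` (`stub_windowTransport`, `infDist_image_lt_of_window`, `measure_mono_ae`,
`Measure.le_map_apply`) gives `P[dist(u₀, γ) < ρ] ≤ C L² ρ²` for `ρ < min(η, r₀/L)`, and the
half-plane pin `kappa_le_of_upper` (Beffara's lower estimate for `κ < 8`, space filling for
`κ ≥ 8`) concludes. [cite: Beffara2008, Prop. 4] -/
theorem stub_kappaLeOfUpper :
    ∀ (κ : ℝ≥0) (D : DobrushinDomain) (μ : Measure (CurveClass ℂ)) (x₀ : ℂ) (ρ₀ : ℝ),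
      0 < κ → IsSLELaw κ D μ → 0 < ρ₀ →
      D.carrier ∩ Metric.ball x₀ ρ₀ = {z : ℂ | x₀.im < z.im} ∩ Metric.ball x₀ ρ₀ →
      x₀ ≠ D.pt 0 → x₀ ≠ D.pt 1 →
      (∃ C r₀ : ℝ, 0 < r₀ ∧ ∀ r ∈ Set.Ioo (0 : ℝ) r₀,
          μ {γ | Metric.infDist x₀ γ.range < r} ≤ ENNReal.ofReal (C * r ^ 2)) →
      κ ≤ 8 / 3 := by
  intro κ D μ x₀ ρ₀ hκ hμ hρ₀ hwin hx0 hx1 hup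
  have hT : HasSLETrace κ := hμ.hasSLETrace
  obtain ⟨Γ, ⟨hΓ, φ, hφ, hae⟩, rfl⟩ := hμ
  obtain ⟨u₀, L, η, hu₀, hL, hη, hLip⟩ := stub_windowTransport D x₀ ρ₀ hρ₀ hwin hx0 hx1 φ hφ
  obtain ⟨C, r₀, hr₀, hup⟩ := hup
  -- the almost sure transport of distances from the trace in `ℍ` to the curve in `D`
  have hgood : ∀ᵐ ω ∂preWienerMeasure,
      ∀ ρ : ℝ, ρ ≤ η → Metric.infDist (u₀ : ℂ) (Set.range (sleTrace κ ω)) < ρ →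
        Metric.infDist x₀ (Γ ω).range < L * ρ := by
    filter_upwards [hae] with ω hω
    obtain ⟨-, c, hΓω, hc⟩ := hω
    rw [hΓω, CurveClass.range_mk]
    exact fun ρ hρ h => infDist_image_lt_of_window hc (sleTrace_im_nonneg κ ω) hL hLip hρ h
  -- the upper `r²` law of `μ` at `x₀` gives one for the trace at `u₀`, constants `C L²`,
  -- `min η (r₀ / L)`
  refine kappa_le_of_upper hκ hT hu₀ (C := C * L ^ 2) (lt_min hη (div_pos hr₀ hL))
    fun ρ hρ => ?_
  obtain ⟨hρ0, hρ1⟩ := hρ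
  have hρη : ρ < η := hρ1.trans_le (min_le_left _ _)
  have hLρ : L * ρ < r₀ := (lt_div_iff₀' hL).1 (hρ1.trans_le (min_le_right _ _))
  calc preWienerMeasure {ω | Metric.infDist (u₀ : ℂ) (Set.range (sleTrace κ ω)) < ρ}
      ≤ preWienerMeasure (Γ ⁻¹' {γ | Metric.infDist x₀ γ.range < L * ρ}) := by
        refine measure_mono_ae ?_
        filter_upwards [hgood] with ω hω hlt
        exact hω _ hρη.le hlt
    _ ≤ preWienerMeasure.map Γ {γ | Metric.infDist x₀ γ.range < L * ρ} :=
        Measure.le_map_apply hΓ _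
    _ ≤ ENNReal.ofReal (C * (L * ρ) ^ 2) := hup _ ⟨mul_pos hL hρ0, hLρ⟩
    _ = ENNReal.ofReal (C * L ^ 2 * ρ ^ 2) := by
        congr 1
        ring

end Summit.CriticalPhenomena.SAWScalingLimit.Theorems.SubseqIdentification.BoundaryAreaLaw
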